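import Summits.QuantumFields.YangMills.Theorems.UnitScaleTiltProp7Taylor3Action
import HarnessLib

/-!
# Route `UnitScaleTilt`, crux K1 «MinimiserStabilityRegPr» (stmt-QuantumFields-19200), lane α-P (★★OWNER RULING №30 (2): HESS_W ∕ TAYLOR_W ∕ CHART_W) —
# TAYLOR3′_W: THE THIRD-ORDER REMAINDER OF THE EXPONENTIAL CHART `D ↦ A(e^{iD}W)` IN CURL CURRENCY,
# `|A(e^{iD}W) − A(W) − ℓ_W(D) − q_W(D)| ≤ (216·t + 7776·s² + 768·a·s)·Σ_b‖D(b)‖²` with `‖ℒ_p(D)‖ ≤ t`, `‖D(b)‖ ≤ s`, `‖W(∂p) − 1‖ ≤ a`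

Cell `ym3-torus`, keyed width hand `ym-routeR-w1` gen 2 (D-0154 (3c); LOCATE + offer (t1) 2026-08-28 11:27Z on the cell bus).  THEOREMS ONLY (0 `def`, 0 `sorry`);
`--supports stmt-QuantumFields-19200`, count-neutral.  YM₃ on T³ is a ladder rung (R3), not the Clay problem; nothing here claims the stub, the crux, d = 4 or the mass gap.

WHY (the located scaling gap).  The chart knit ✓ `Prop7Growth142T3ChartKnit.cmin_minimality_of_chartRows` closes C-min's minimality clause from CHART_W ∧ EL_W ∧ HESS_W under
`4800·s + lam ≤ κ`, with the landed TAYLOR3_W ✓ `Prop7Taylor3Word.neg_le_wilsonAction4_expChart_sub_taylor2` (`≤ 4800·s·Σ‖D‖²`, per plaquette `25σ³`) inside.  In the scale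
`η = L^{−(K−n)}`: competitors of C-min's ball have `‖X′(b)‖ ≤ ε₄·η` ((19), ✓ `Prop7TPrintDefs.nMax19`), so the chart's sup radius is `s = O(η)`, while on any fibre-tangent
slice HESS_W's `ℓ²`-coercivity constant is `κ = O(η²)` (block Poincaré is saturated at scale `η⁻¹`; e.g. ★routeR-w3 g2's core gives `η²∕(4(18 + 537600L⁴))`) and EL_W's
`lam = O(η²)` — so `4800·s ≤ κ` fails for `K − n` large.  The cure is in the bookkeeping, not in the mathematics: the cubic term of the action is `Re⟨ℒ_p, x_p − ℒ_p⟩`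
(`ℒ_p` = the linearised relative plaquette variable = the covariant curl of `iD` at `W`), of size `‖ℒ_p‖·σ_p²`, and the background pairing is `‖W(∂p) − 1‖·4σ_p³`; displaying
`‖ℒ_p(D)‖ ≤ t` ((19)'s gradient row transported by the chart, `t = O(η²)`) and `‖W(∂p) − 1‖ ≤ a` ((14), `a = O(η²)`) makes every coefficient `O(η²)`: `216t + 7776s² + 768as`.
With `t := 4s`, `a := 2` (always available) one recovers the landed row up to constants.

WHAT IS PROVED (ns `…Theorems.Prop7Taylor3ActionCurl`; `W` ANY configuration of the finest T³ lattice, `SU(2)`).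
* §1 `curl_bookkeeping` (reals: `½A(A + 2B) + aC ≤ ((9∕2)t + 162s² + 16as)·σ²` for `A ≤ ½σ² + 4σ³`, `B ≤ t`, `C ≤ 4σ³`, `σ ≤ 4s ≤ 1`).
* §2 ★ `abs_plaq_action_sub_taylor2_le_curl` — the per-plaquette remainder, abstract letters `P₀, x, ℒ, 𝒬` as in ✓ `…abs_plaq_action_sub_taylor2_le`, with `‖ℒ‖ ≤ t`, `‖P₀ − 1‖ ≤ a`.
* §3 `sq_sum_le`; ★★ `abs_wilsonAction4_expChart_sub_taylor2_le_curl` (the title row; Taylor polynomial text VERBATIM the landed one; incidence `4d = 12`, `σ_p² ≤ 4Σ_{∂p}‖D‖²`);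
  ★★ `neg_le_wilsonAction4_expChart_sub_taylor2_curl` (the one-sided `hT` shape).
HONEST SCOPE.  Bookkeeping over ✓ `Prop7Taylor3Word` §5 (`‖x − ℒ − 𝒬‖ ≤ 4σ³`) and p1's exact action identity; absolute constants, no smallness of the background; nothing of
[Balaban1985Variational] is asserted.  The knit-side change (`hκ : 216t + 7776s² + 768as + lam ≤ κ` and a CHART_W clause delivering `t`) is NOT made here.

References: T. Bałaban, CMP 102 (1985) 277–309 [Balaban1985Variational] ((19) p.281, (22)–(31) pp.281–283, (112) p.294, (141)–(143) p.299).
-/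

set_option autoImplicit false

noncomputable section

open scoped BigOperators Matrix.Norms.L2Operator Matrix

namespace Summit.QuantumFields.YangMills.Theorems.Prop7Taylor3ActionCurl

open NormedSpace
open Literature.MathematicalPhysics.QuantumFieldTheory.Balaban1983to89
open Literature.MathematicalPhysics.QuantumFieldTheory.Balaban1983to89.T3ContinuumYM3Torus
open Literature.MathematicalPhysics.QuantumFieldTheory.Balaban1983to89.T3SectALandauChart (emb15)
open Summit.QuantumFields.YangMills.Theorems.Prop7TPrint (expHerm coe_expHerm expHermField expHermField_apply)
open Summit.QuantumFields.YangMills.Theorems.Prop7Taylor3ExpChart (norm_I_smul)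
open Summit.QuantumFields.YangMills.Theorems.PerturbedPlaquette (norm_conj_SU)
open Summit.QuantumFields.YangMills.Theorems.Prop7ExactExpansion (wilsonAction4_sub_eq_relPlaq abs_half_re_trace_sub_le)
open Summit.QuantumFields.YangMills.Theorems.Prop7FlatLocalMin (sum_plaq_bonds_le)
open Summit.QuantumFields.YangMills.Theorems.Prop7Taylor3Word (norm_quad_le norm_relPlaq_expChart_sub_lin_sub_quad_le abs_sq_norm_sub_sq_norm_le)

/-! ## §1 The cubic bookkeeping in curl currency (real numbers) -/

/-- The curl-currency bookkeeping of the per-plaquette remainder: with `A = ‖x − ℒ‖ ≤ ½σ² + 4σ³`, `‖ℒ‖ ≤ t`, `C ≤ 4σ³`, `‖P₀ − 1‖ ≤ a`, `σ ≤ 4s ≤ 1`: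
`½A(A + 2‖ℒ‖) + aC ≤ ((9∕2)t + 162s² + 16as)·σ²`. [folklore] -/
theorem curl_bookkeeping {A B C σ s t a : ℝ} (hσ0 : 0 ≤ σ) (hσs : σ ≤ 4 * s) (hs4 : 4 * s ≤ 1) (ha0 : 0 ≤ a)
    (hA0 : 0 ≤ A) (hA : A ≤ (1 / 2) * σ ^ 2 + 4 * σ ^ 3) (hB0 : 0 ≤ B) (hB : B ≤ t) (hC : C ≤ 4 * σ ^ 3) :
    (1 / 2) * (A * (A + 2 * B)) + a * C ≤ ((9 / 2) * t + 162 * s ^ 2 + 16 * a * s) * σ ^ 2 := by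
  have hσ1 : σ ≤ 1 := hσs.trans hs4
  have s32 : σ ^ 3 ≤ σ ^ 2 := by nlinarith
  have hA' : A ≤ (9 / 2) * σ ^ 2 := by linarith
  have hσ2 : σ ^ 2 ≤ 16 * s ^ 2 := by nlinarith
  -- `½A² ≤ ½(9/2)²σ⁴ ≤ (81/8)·16 s²·σ² = 162 s²σ²`
  have hAA : A * A ≤ ((9 / 2) * σ ^ 2) * ((9 / 2) * σ ^ 2) := mul_le_mul hA' hA' hA0 (by positivity)
  have h1 : (1 / 2) * (A * A) ≤ 162 * s ^ 2 * σ ^ 2 := by nlinarith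
  -- `A·B ≤ (9/2)σ²·t`
  have h2 : A * B ≤ ((9 / 2) * σ ^ 2) * t := mul_le_mul hA' hB hB0 (by positivity)
  -- `a·C ≤ 4aσ³ ≤ 16 a s σ²`
  have h3 : a * C ≤ a * (4 * σ ^ 3) := mul_le_mul_of_nonneg_left hC ha0
  have h4 : a * (4 * σ ^ 3) ≤ 16 * a * s * σ ^ 2 := by nlinarith [mul_nonneg ha0 (sq_nonneg σ)]
  nlinarith

/-! ## §2 The action-level remainder per plaquette, abstractly, in curl currency -/

/-- **THE ACTION-LEVEL REMAINDER PER PLAQUETTE, CURL CURRENCY**: as ✓ `Prop7Taylor3Word.abs_plaq_action_sub_taylor2_le` but with a SEPARATE bound `‖ℒ‖ ≤ t` on the linear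
part (the linearised relative plaquette variable = the covariant curl) and `‖P₀ − 1‖ ≤ a` on the background plaquette:
`|½‖x‖² + ½Re Tr((P₀−1)^* x P₀) − ½Re Tr((P₀−1)^* ℒ P₀) − (½‖ℒ‖² + ½Re Tr((P₀−1)^* 𝒬 P₀))| ≤ ((9∕2)t + 162s² + 16as)·σ²` (`σ ≤ 4s ≤ 1`) — the cubic term is
`Re⟨ℒ, x − ℒ⟩ = O(t·σ²)`, not `O(σ³)`. [cite: Balaban1985Variational, (26)-(31) pp.282-283, (141)-(142) p.299] -/
theorem abs_plaq_action_sub_taylor2_le_curl (P₀ x L Q : Matrix (Fin 2) (Fin 2) ℂ) (hP : P₀ ∈ Matrix.unitaryGroup (Fin 2) ℂ) {σ s t a : ℝ} (hσ0 : 0 ≤ σ)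
    (hσs : σ ≤ 4 * s) (hs4 : 4 * s ≤ 1) (ha0 : 0 ≤ a)
    (hLt : ‖L‖ ≤ t) (hPa : ‖P₀ - 1‖ ≤ a) (hQ : ‖Q‖ ≤ (1 / 2) * σ ^ 2) (hR : ‖x - L - Q‖ ≤ 4 * σ ^ 3) :
    |(1 / 2) * ‖x‖ ^ 2 + (1 / 2) * (((P₀ - 1)ᴴ * (x * P₀)).trace).re - (1 / 2) * (((P₀ - 1)ᴴ * (L * P₀)).trace).re
        - ((1 / 2) * ‖L‖ ^ 2 + (1 / 2) * (((P₀ - 1)ᴴ * (Q * P₀)).trace).re)| ≤ ((9 / 2) * t + 162 * s ^ 2 + 16 * a * s) * σ ^ 2 := by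
  have hlin : (1 / 2) * (((P₀ - 1)ᴴ * (x * P₀)).trace).re - (1 / 2) * (((P₀ - 1)ᴴ * (L * P₀)).trace).re
        - (1 / 2) * (((P₀ - 1)ᴴ * (Q * P₀)).trace).re = (1 / 2) * (((P₀ - 1)ᴴ * ((x - L - Q) * P₀)).trace).re := by
    simp only [sub_mul, Matrix.mul_sub, Matrix.trace_sub, Complex.sub_re]; ring
  have e : (1 / 2) * ‖x‖ ^ 2 + (1 / 2) * (((P₀ - 1)ᴴ * (x * P₀)).trace).re - (1 / 2) * (((P₀ - 1)ᴴ * (L * P₀)).trace).re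
        - ((1 / 2) * ‖L‖ ^ 2 + (1 / 2) * (((P₀ - 1)ᴴ * (Q * P₀)).trace).re)
      = (1 / 2) * (‖x‖ ^ 2 - ‖L‖ ^ 2) + (1 / 2) * (((P₀ - 1)ᴴ * ((x - L - Q) * P₀)).trace).re := by
    rw [← hlin]; ring
  rw [e]
  have hpair : |(1 / 2) * (((P₀ - 1)ᴴ * ((x - L - Q) * P₀)).trace).re| ≤ ‖P₀ - 1‖ * ‖x - L - Q‖ := by
    have h0 := abs_half_re_trace_sub_le P₀ (x - L - Q) 0 hP
    rwa [zero_mul, mul_zero, Matrix.trace_zero, Complex.zero_re, mul_zero, sub_zero, sub_zero] at h0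
  have hsq := abs_sq_norm_sub_sq_norm_le x L
  have hxL : ‖x - L‖ ≤ (1 / 2) * σ ^ 2 + 4 * σ ^ 3 := by
    have hx : x - L = Q + (x - L - Q) := by abel
    rw [hx]; exact (norm_add_le _ _).trans (add_le_add hQ hR)
  have ha' : |(1 / 2) * (‖x‖ ^ 2 - ‖L‖ ^ 2)| ≤ (1 / 2) * (‖x - L‖ * (‖x - L‖ + 2 * ‖L‖)) := by
    rw [abs_mul, abs_of_pos (by norm_num : (0 : ℝ) < 1 / 2)]
    exact mul_le_mul_of_nonneg_left hsq (by norm_num)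
  have hb : |(1 / 2) * (((P₀ - 1)ᴴ * ((x - L - Q) * P₀)).trace).re| ≤ a * ‖x - L - Q‖ :=
    hpair.trans (mul_le_mul_of_nonneg_right hPa (norm_nonneg _))
  have hbk := curl_bookkeeping hσ0 hσs hs4 ha0 (norm_nonneg (x - L)) hxL (norm_nonneg L) hLt hR
  have hb' : a * ‖x - L - Q‖ ≤ a * (4 * σ ^ 3) := mul_le_mul_of_nonneg_left hR ha0
  exact (abs_add_le _ _).trans (by nlinarith [hbk, ha', hb, hb', mul_le_mul_of_nonneg_left hR ha0])

/-! ## §3 ★ TAYLOR3′_W: the summed row in curl currency -/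

variable {F : T3Family} {K : ℕ}

/-- `σ_p² ≤ 4·Σ_{b∈∂p}‖D(b)‖²`. [folklore] -/
theorem sq_sum_le {e₁ e₂ e₃ e₄ : ℝ} :
    (e₁ + e₂ + e₃ + e₄) ^ 2 ≤ 4 * (e₁ ^ 2 + e₂ ^ 2 + e₃ ^ 2 + e₄ ^ 2) := by
  nlinarith [sq_nonneg (e₁ - e₂), sq_nonneg (e₁ - e₃), sq_nonneg (e₁ - e₄), sq_nonneg (e₂ - e₃), sq_nonneg (e₂ - e₄), sq_nonneg (e₃ - e₄)]

set_option maxHeartbeats 400000 in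
/-- ★ **TAYLOR3′_W — THE THIRD-ORDER REMAINDER OF `D ↦ A(e^{iD}W)` IN CURL CURRENCY.**  Same Taylor polynomial `ℓ_W(D) + q_W(D)` as ✓ `Prop7Taylor3Word.abs_wilsonAction4_expChart_sub_taylor2_le`
(text VERBATIM), `D` Hermitian traceless with `‖D(b)‖ ≤ s`, `4s ≤ 1`; two EXTRA displayed sizes: `‖ℒ_p(D)‖ ≤ t` for every plaquette (the linearised relative plaquette variable =
the covariant curl of `iD` at `W`) and `‖W(∂p) − 1‖ ≤ a`.  THEN
`|A(e^{iD}W) − A(W) − ℓ_W(D) − q_W(D)| ≤ (216·t + 7776·s² + 768·a·s)·Σ_b‖D(b)‖²`.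
WHY: every coefficient is of SECOND order in the scale `η = L^{−(K−n)}` when `s = O(η)`, `t = O(η²)` ((19)'s gradient row), `a = O(η²)` ((14)), whereas the landed row's `4800·s` is
of FIRST order — so the chart knit's smallness condition `(remainder coefficient) + lam ≤ κ`, `κ = O(η²)`, becomes `L`-only. [cite: Balaban1985Variational, (141)-(142) p.299, (26)-(31) pp.282-283, (19) p.281] -/
theorem abs_wilsonAction4_expChart_sub_taylor2_le_curl (W : GaugeField (F.P K) 0 (Matrix.specialUnitaryGroup (Fin 2) ℂ)) (D : PBond (F.P K) 0 → Matrix (Fin 2) (Fin 2) ℂ)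
    (hD : ∀ b : PBond (F.P K) 0, (D b).IsHermitian ∧ Matrix.trace (D b) = 0) {s : ℝ} (hs0 : 0 ≤ s) (hs : ∀ b : PBond (F.P K) 0, ‖D b‖ ≤ s)
    (hs4 : 4 * s ≤ 1) {t a : ℝ} (ht0 : 0 ≤ t) (ha0 : 0 ≤ a)
    (ht : ∀ p : Plaq (F.P K) 0, ‖((Complex.I • D ⟨p.src, p.μ⟩) + ((W ⟨p.src, p.μ⟩ : Matrix (Fin 2) (Fin 2) ℂ) * (Complex.I • D ⟨p.src.shift p.μ, p.ν⟩) * star (W ⟨p.src, p.μ⟩ : Matrix (Fin 2) (Fin 2) ℂ))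
            - (((W ⟨p.src, p.μ⟩ * W ⟨p.src.shift p.μ, p.ν⟩ * (W ⟨p.src.shift p.ν, p.μ⟩)⁻¹ : Matrix.specialUnitaryGroup (Fin 2) ℂ) : Matrix (Fin 2) (Fin 2) ℂ) * (Complex.I • D ⟨p.src.shift p.ν, p.μ⟩) * star ((W ⟨p.src, p.μ⟩ * W ⟨p.src.shift p.μ, p.ν⟩ * (W ⟨p.src.shift p.ν, p.μ⟩)⁻¹ : Matrix.specialUnitaryGroup (Fin 2) ℂ) : Matrix (Fin 2) (Fin 2) ℂ))
            - (((GaugeField.plaqHol W p : Matrix.specialUnitaryGroup (Fin 2) ℂ) : Matrix (Fin 2) (Fin 2) ℂ) * (Complex.I • D ⟨p.src, p.ν⟩) * star ((GaugeField.plaqHol W p : Matrix.specialUnitaryGroup (Fin 2) ℂ) : Matrix (Fin 2) (Fin 2) ℂ)))‖ ≤ t)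
    (ha : ∀ p : Plaq (F.P K) 0, ‖(((GaugeField.plaqHol W p : Matrix.specialUnitaryGroup (Fin 2) ℂ) : Matrix (Fin 2) (Fin 2) ℂ) - 1)‖ ≤ a) :
    |wilsonAction4 (emb15 W (expHermField D)) - wilsonAction4 W
        - ∑ p : Plaq (F.P K) 0, (1 / 2) * (((((GaugeField.plaqHol W p : Matrix.specialUnitaryGroup (Fin 2) ℂ) : Matrix (Fin 2) (Fin 2) ℂ) - 1)ᴴ * (((Complex.I • D ⟨p.src, p.μ⟩) + ((W ⟨p.src, p.μ⟩ : Matrix (Fin 2) (Fin 2) ℂ) * (Complex.I • D ⟨p.src.shift p.μ, p.ν⟩) * star (W ⟨p.src, p.μ⟩ : Matrix (Fin 2) (Fin 2) ℂ))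
            - (((W ⟨p.src, p.μ⟩ * W ⟨p.src.shift p.μ, p.ν⟩ * (W ⟨p.src.shift p.ν, p.μ⟩)⁻¹ : Matrix.specialUnitaryGroup (Fin 2) ℂ) : Matrix (Fin 2) (Fin 2) ℂ) * (Complex.I • D ⟨p.src.shift p.ν, p.μ⟩) * star ((W ⟨p.src, p.μ⟩ * W ⟨p.src.shift p.μ, p.ν⟩ * (W ⟨p.src.shift p.ν, p.μ⟩)⁻¹ : Matrix.specialUnitaryGroup (Fin 2) ℂ) : Matrix (Fin 2) (Fin 2) ℂ))
            - (((GaugeField.plaqHol W p : Matrix.specialUnitaryGroup (Fin 2) ℂ) : Matrix (Fin 2) (Fin 2) ℂ) * (Complex.I • D ⟨p.src, p.ν⟩) * star ((GaugeField.plaqHol W p : Matrix.specialUnitaryGroup (Fin 2) ℂ) : Matrix (Fin 2) (Fin 2) ℂ))) * ((GaugeField.plaqHol W p : Matrix.specialUnitaryGroup (Fin 2) ℂ) : Matrix (Fin 2) (Fin 2) ℂ))).trace).re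
        - ∑ p : Plaq (F.P K) 0, ((1 / 2) * ‖((Complex.I • D ⟨p.src, p.μ⟩) + ((W ⟨p.src, p.μ⟩ : Matrix (Fin 2) (Fin 2) ℂ) * (Complex.I • D ⟨p.src.shift p.μ, p.ν⟩) * star (W ⟨p.src, p.μ⟩ : Matrix (Fin 2) (Fin 2) ℂ))
            - (((W ⟨p.src, p.μ⟩ * W ⟨p.src.shift p.μ, p.ν⟩ * (W ⟨p.src.shift p.ν, p.μ⟩)⁻¹ : Matrix.specialUnitaryGroup (Fin 2) ℂ) : Matrix (Fin 2) (Fin 2) ℂ) * (Complex.I • D ⟨p.src.shift p.ν, p.μ⟩) * star ((W ⟨p.src, p.μ⟩ * W ⟨p.src.shift p.μ, p.ν⟩ * (W ⟨p.src.shift p.ν, p.μ⟩)⁻¹ : Matrix.specialUnitaryGroup (Fin 2) ℂ) : Matrix (Fin 2) (Fin 2) ℂ))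
            - (((GaugeField.plaqHol W p : Matrix.specialUnitaryGroup (Fin 2) ℂ) : Matrix (Fin 2) (Fin 2) ℂ) * (Complex.I • D ⟨p.src, p.ν⟩) * star ((GaugeField.plaqHol W p : Matrix.specialUnitaryGroup (Fin 2) ℂ) : Matrix (Fin 2) (Fin 2) ℂ)))‖ ^ 2
          + (1 / 2) * (((((GaugeField.plaqHol W p : Matrix.specialUnitaryGroup (Fin 2) ℂ) : Matrix (Fin 2) (Fin 2) ℂ) - 1)ᴴ * (((2 : ℂ)⁻¹ • ((Complex.I • D ⟨p.src, p.μ⟩) ^ 2 + ((W ⟨p.src, p.μ⟩ : Matrix (Fin 2) (Fin 2) ℂ) * (Complex.I • D ⟨p.src.shift p.μ, p.ν⟩) * star (W ⟨p.src, p.μ⟩ : Matrix (Fin 2) (Fin 2) ℂ)) ^ 2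
              + (((W ⟨p.src, p.μ⟩ * W ⟨p.src.shift p.μ, p.ν⟩ * (W ⟨p.src.shift p.ν, p.μ⟩)⁻¹ : Matrix.specialUnitaryGroup (Fin 2) ℂ) : Matrix (Fin 2) (Fin 2) ℂ) * (Complex.I • D ⟨p.src.shift p.ν, p.μ⟩) * star ((W ⟨p.src, p.μ⟩ * W ⟨p.src.shift p.μ, p.ν⟩ * (W ⟨p.src.shift p.ν, p.μ⟩)⁻¹ : Matrix.specialUnitaryGroup (Fin 2) ℂ) : Matrix (Fin 2) (Fin 2) ℂ)) ^ 2
              + (((GaugeField.plaqHol W p : Matrix.specialUnitaryGroup (Fin 2) ℂ) : Matrix (Fin 2) (Fin 2) ℂ) * (Complex.I • D ⟨p.src, p.ν⟩) * star ((GaugeField.plaqHol W p : Matrix.specialUnitaryGroup (Fin 2) ℂ) : Matrix (Fin 2) (Fin 2) ℂ)) ^ 2)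
            + (Complex.I • D ⟨p.src, p.μ⟩) * ((W ⟨p.src, p.μ⟩ : Matrix (Fin 2) (Fin 2) ℂ) * (Complex.I • D ⟨p.src.shift p.μ, p.ν⟩) * star (W ⟨p.src, p.μ⟩ : Matrix (Fin 2) (Fin 2) ℂ))
            - (Complex.I • D ⟨p.src, p.μ⟩) * (((W ⟨p.src, p.μ⟩ * W ⟨p.src.shift p.μ, p.ν⟩ * (W ⟨p.src.shift p.ν, p.μ⟩)⁻¹ : Matrix.specialUnitaryGroup (Fin 2) ℂ) : Matrix (Fin 2) (Fin 2) ℂ) * (Complex.I • D ⟨p.src.shift p.ν, p.μ⟩) * star ((W ⟨p.src, p.μ⟩ * W ⟨p.src.shift p.μ, p.ν⟩ * (W ⟨p.src.shift p.ν, p.μ⟩)⁻¹ : Matrix.specialUnitaryGroup (Fin 2) ℂ) : Matrix (Fin 2) (Fin 2) ℂ))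
            - (Complex.I • D ⟨p.src, p.μ⟩) * (((GaugeField.plaqHol W p : Matrix.specialUnitaryGroup (Fin 2) ℂ) : Matrix (Fin 2) (Fin 2) ℂ) * (Complex.I • D ⟨p.src, p.ν⟩) * star ((GaugeField.plaqHol W p : Matrix.specialUnitaryGroup (Fin 2) ℂ) : Matrix (Fin 2) (Fin 2) ℂ))
            - ((W ⟨p.src, p.μ⟩ : Matrix (Fin 2) (Fin 2) ℂ) * (Complex.I • D ⟨p.src.shift p.μ, p.ν⟩) * star (W ⟨p.src, p.μ⟩ : Matrix (Fin 2) (Fin 2) ℂ))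
                * (((W ⟨p.src, p.μ⟩ * W ⟨p.src.shift p.μ, p.ν⟩ * (W ⟨p.src.shift p.ν, p.μ⟩)⁻¹ : Matrix.specialUnitaryGroup (Fin 2) ℂ) : Matrix (Fin 2) (Fin 2) ℂ) * (Complex.I • D ⟨p.src.shift p.ν, p.μ⟩) * star ((W ⟨p.src, p.μ⟩ * W ⟨p.src.shift p.μ, p.ν⟩ * (W ⟨p.src.shift p.ν, p.μ⟩)⁻¹ : Matrix.specialUnitaryGroup (Fin 2) ℂ) : Matrix (Fin 2) (Fin 2) ℂ))
            - ((W ⟨p.src, p.μ⟩ : Matrix (Fin 2) (Fin 2) ℂ) * (Complex.I • D ⟨p.src.shift p.μ, p.ν⟩) * star (W ⟨p.src, p.μ⟩ : Matrix (Fin 2) (Fin 2) ℂ))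
                * (((GaugeField.plaqHol W p : Matrix.specialUnitaryGroup (Fin 2) ℂ) : Matrix (Fin 2) (Fin 2) ℂ) * (Complex.I • D ⟨p.src, p.ν⟩) * star ((GaugeField.plaqHol W p : Matrix.specialUnitaryGroup (Fin 2) ℂ) : Matrix (Fin 2) (Fin 2) ℂ))
            + (((W ⟨p.src, p.μ⟩ * W ⟨p.src.shift p.μ, p.ν⟩ * (W ⟨p.src.shift p.ν, p.μ⟩)⁻¹ : Matrix.specialUnitaryGroup (Fin 2) ℂ) : Matrix (Fin 2) (Fin 2) ℂ) * (Complex.I • D ⟨p.src.shift p.ν, p.μ⟩) * star ((W ⟨p.src, p.μ⟩ * W ⟨p.src.shift p.μ, p.ν⟩ * (W ⟨p.src.shift p.ν, p.μ⟩)⁻¹ : Matrix.specialUnitaryGroup (Fin 2) ℂ) : Matrix (Fin 2) (Fin 2) ℂ))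
                * (((GaugeField.plaqHol W p : Matrix.specialUnitaryGroup (Fin 2) ℂ) : Matrix (Fin 2) (Fin 2) ℂ) * (Complex.I • D ⟨p.src, p.ν⟩) * star ((GaugeField.plaqHol W p : Matrix.specialUnitaryGroup (Fin 2) ℂ) : Matrix (Fin 2) (Fin 2) ℂ))) * ((GaugeField.plaqHol W p : Matrix.specialUnitaryGroup (Fin 2) ℂ) : Matrix (Fin 2) (Fin 2) ℂ))).trace).re)|
      ≤ (216 * t + 7776 * s ^ 2 + 768 * a * s) * ∑ b : PBond (F.P K) 0, ‖D b‖ ^ 2 := by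
  have h1 : ∀ b : PBond (F.P K) 0, ‖D b‖ ≤ 1 := fun b => (hs b).trans (by linarith)
  rw [wilsonAction4_sub_eq_relPlaq (emb15 W (expHermField D)) W, ← Finset.sum_sub_distrib, ← Finset.sum_sub_distrib]
  refine (Finset.abs_sum_le_sum_abs _ _).trans ?_
  -- incidence: each bond lies in `4d = 12` plaquette slots
  have hinc := sum_plaq_bonds_le (P := F.P K) (j := 0) (fun b => ‖D b‖ ^ 2) (fun b => sq_nonneg _)
  have hd : ((F.P K).d : ℝ) = 3 := by norm_num [T3Family.P_d]
  rw [hd] at hinc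
  have hcoef0 : 0 ≤ (9 / 2) * t + 162 * s ^ 2 + 16 * a * s := by positivity
  refine (Finset.sum_le_sum (g := fun p : Plaq (F.P K) 0 => (((9 / 2) * t + 162 * s ^ 2 + 16 * a * s) * 4) *
      (‖D ⟨p.src, p.μ⟩‖ ^ 2 + ‖D ⟨p.src.shift p.μ, p.ν⟩‖ ^ 2 + ‖D ⟨p.src.shift p.ν, p.μ⟩‖ ^ 2 + ‖D ⟨p.src, p.ν⟩‖ ^ 2))
    fun p _ => ?_).trans ?_
  · -- per plaquette: §5 of T3W + the curl-currency bookkeeping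
    have n₁ : ‖(Complex.I • D ⟨p.src, p.μ⟩)‖ ≤ ‖D ⟨p.src, p.μ⟩‖ := (norm_I_smul _).le
    have n₂ : ‖((W ⟨p.src, p.μ⟩ : Matrix (Fin 2) (Fin 2) ℂ) * (Complex.I • D ⟨p.src.shift p.μ, p.ν⟩) * star (W ⟨p.src, p.μ⟩ : Matrix (Fin 2) (Fin 2) ℂ))‖ ≤ ‖D ⟨p.src.shift p.μ, p.ν⟩‖ := by
      rw [norm_conj_SU, norm_I_smul]
    have n₃ : ‖(((W ⟨p.src, p.μ⟩ * W ⟨p.src.shift p.μ, p.ν⟩ * (W ⟨p.src.shift p.ν, p.μ⟩)⁻¹ : Matrix.specialUnitaryGroup (Fin 2) ℂ) : Matrix (Fin 2) (Fin 2) ℂ) * (Complex.I • D ⟨p.src.shift p.ν, p.μ⟩) * star ((W ⟨p.src, p.μ⟩ * W ⟨p.src.shift p.μ, p.ν⟩ * (W ⟨p.src.shift p.ν, p.μ⟩)⁻¹ : Matrix.specialUnitaryGroup (Fin 2) ℂ) : Matrix (Fin 2) (Fin 2) ℂ))‖ ≤ ‖D ⟨p.src.shift p.ν, p.μ⟩‖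 := by
      rw [norm_conj_SU, norm_I_smul]
    have n₄ : ‖(((GaugeField.plaqHol W p : Matrix.specialUnitaryGroup (Fin 2) ℂ) : Matrix (Fin 2) (Fin 2) ℂ) * (Complex.I • D ⟨p.src, p.ν⟩) * star ((GaugeField.plaqHol W p : Matrix.specialUnitaryGroup (Fin 2) ℂ) : Matrix (Fin 2) (Fin 2) ℂ))‖ ≤ ‖D ⟨p.src, p.ν⟩‖ := by
      rw [norm_conj_SU, norm_I_smul]
    have hQ := norm_quad_le _ _ _ _ (norm_nonneg _) (norm_nonneg _) (norm_nonneg _) (norm_nonneg _) n₁ n₂ n₃ n₄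
    have hR := norm_relPlaq_expChart_sub_lin_sub_quad_le W D p hD h1
    have hσs : (‖D ⟨p.src, p.μ⟩‖ + ‖D ⟨p.src.shift p.μ, p.ν⟩‖ + ‖D ⟨p.src.shift p.ν, p.μ⟩‖ + ‖D ⟨p.src, p.ν⟩‖) ≤ 4 * s := by
      linarith [hs ⟨p.src, p.μ⟩, hs ⟨p.src.shift p.μ, p.ν⟩, hs ⟨p.src.shift p.ν, p.μ⟩, hs ⟨p.src, p.ν⟩]
    have hsq := @sq_sum_le ‖D ⟨p.src, p.μ⟩‖ ‖D ⟨p.src.shift p.μ, p.ν⟩‖ ‖D ⟨p.src.shift p.ν, p.μ⟩‖ ‖D ⟨p.src, p.ν⟩‖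
    refine (abs_plaq_action_sub_taylor2_le_curl _ _ _ _ (GaugeField.plaqHol W p).2.1 (by positivity) hσs hs4 ha0 (ht p) (ha p) hQ hR).trans ?_
    have := mul_le_mul_of_nonneg_left hsq hcoef0
    linarith
  · rw [← Finset.mul_sum]
    have := mul_le_mul_of_nonneg_left hinc (show (0 : ℝ) ≤ ((9 / 2) * t + 162 * s ^ 2 + 16 * a * s) * 4 by positivity)
    nlinarith [Finset.sum_nonneg (fun b (_ : b ∈ (Finset.univ : Finset (PBond (F.P K) 0))) => sq_nonneg ‖D b‖)]


/-- **THE `hT` ROW SHAPE, CURL CURRENCY**: `−(216t + 7776s² + 768as)·Σ_b‖D(b)‖² ≤ A(e^{iD}W) − A(W) − ℓ_W(D) − q_W(D)` — the one-sided form a chart knit consumes in place of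
✓ `Prop7Taylor3Word.neg_le_wilsonAction4_expChart_sub_taylor2`. [cite: Balaban1985Variational, (141)-(142) p.299] -/
theorem neg_le_wilsonAction4_expChart_sub_taylor2_curl (W : GaugeField (F.P K) 0 (Matrix.specialUnitaryGroup (Fin 2) ℂ)) (D : PBond (F.P K) 0 → Matrix (Fin 2) (Fin 2) ℂ)
    (hD : ∀ b : PBond (F.P K) 0, (D b).IsHermitian ∧ Matrix.trace (D b) = 0) {s : ℝ} (hs0 : 0 ≤ s) (hs : ∀ b : PBond (F.P K) 0, ‖D b‖ ≤ s)
    (hs4 : 4 * s ≤ 1) {t a : ℝ} (ht0 : 0 ≤ t) (ha0 : 0 ≤ a)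
    (ht : ∀ p : Plaq (F.P K) 0, ‖((Complex.I • D ⟨p.src, p.μ⟩) + ((W ⟨p.src, p.μ⟩ : Matrix (Fin 2) (Fin 2) ℂ) * (Complex.I • D ⟨p.src.shift p.μ, p.ν⟩) * star (W ⟨p.src, p.μ⟩ : Matrix (Fin 2) (Fin 2) ℂ))
            - (((W ⟨p.src, p.μ⟩ * W ⟨p.src.shift p.μ, p.ν⟩ * (W ⟨p.src.shift p.ν, p.μ⟩)⁻¹ : Matrix.specialUnitaryGroup (Fin 2) ℂ) : Matrix (Fin 2) (Fin 2) ℂ) * (Complex.I • D ⟨p.src.shift p.ν, p.μ⟩) * star ((W ⟨p.src, p.μ⟩ * W ⟨p.src.shift p.μ, p.ν⟩ * (W ⟨p.src.shift p.ν, p.μ⟩)⁻¹ : Matrix.specialUnitaryGroup (Fin 2) ℂ) : Matrix (Fin 2) (Fin 2) ℂ))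
            - (((GaugeField.plaqHol W p : Matrix.specialUnitaryGroup (Fin 2) ℂ) : Matrix (Fin 2) (Fin 2) ℂ) * (Complex.I • D ⟨p.src, p.ν⟩) * star ((GaugeField.plaqHol W p : Matrix.specialUnitaryGroup (Fin 2) ℂ) : Matrix (Fin 2) (Fin 2) ℂ)))‖ ≤ t)
    (ha : ∀ p : Plaq (F.P K) 0, ‖(((GaugeField.plaqHol W p : Matrix.specialUnitaryGroup (Fin 2) ℂ) : Matrix (Fin 2) (Fin 2) ℂ) - 1)‖ ≤ a) :
    -((216 * t + 7776 * s ^ 2 + 768 * a * s) * ∑ b : PBond (F.P K) 0, ‖D b‖ ^ 2)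
      ≤ wilsonAction4 (emb15 W (expHermField D)) - wilsonAction4 W
        - ∑ p : Plaq (F.P K) 0, (1 / 2) * (((((GaugeField.plaqHol W p : Matrix.specialUnitaryGroup (Fin 2) ℂ) : Matrix (Fin 2) (Fin 2) ℂ) - 1)ᴴ * (((Complex.I • D ⟨p.src, p.μ⟩) + ((W ⟨p.src, p.μ⟩ : Matrix (Fin 2) (Fin 2) ℂ) * (Complex.I • D ⟨p.src.shift p.μ, p.ν⟩) * star (W ⟨p.src, p.μ⟩ : Matrix (Fin 2) (Fin 2) ℂ))
            - (((W ⟨p.src, p.μ⟩ * W ⟨p.src.shift p.μ, p.ν⟩ * (W ⟨p.src.shift p.ν, p.μ⟩)⁻¹ : Matrix.specialUnitaryGroup (Fin 2) ℂ) : Matrix (Fin 2) (Fin 2) ℂ) * (Complex.I • D ⟨p.src.shift p.ν, p.μ⟩) * star ((W ⟨p.src, p.μ⟩ * W ⟨p.src.shift p.μ, p.ν⟩ * (W ⟨p.src.shift p.ν, p.μ⟩)⁻¹ : Matrix.specialUnitaryGroup (Fin 2) ℂ) : Matrix (Fin 2) (Fin 2) ℂ))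
            - (((GaugeField.plaqHol W p : Matrix.specialUnitaryGroup (Fin 2) ℂ) : Matrix (Fin 2) (Fin 2) ℂ) * (Complex.I • D ⟨p.src, p.ν⟩) * star ((GaugeField.plaqHol W p : Matrix.specialUnitaryGroup (Fin 2) ℂ) : Matrix (Fin 2) (Fin 2) ℂ))) * ((GaugeField.plaqHol W p : Matrix.specialUnitaryGroup (Fin 2) ℂ) : Matrix (Fin 2) (Fin 2) ℂ))).trace).re
        - ∑ p : Plaq (F.P K) 0, ((1 / 2) * ‖((Complex.I • D ⟨p.src, p.μ⟩) + ((W ⟨p.src, p.μ⟩ : Matrix (Fin 2) (Fin 2) ℂ) * (Complex.I • D ⟨p.src.shift p.μ, p.ν⟩) * star (W ⟨p.src, p.μ⟩ : Matrix (Fin 2) (Fin 2) ℂ))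
            - (((W ⟨p.src, p.μ⟩ * W ⟨p.src.shift p.μ, p.ν⟩ * (W ⟨p.src.shift p.ν, p.μ⟩)⁻¹ : Matrix.specialUnitaryGroup (Fin 2) ℂ) : Matrix (Fin 2) (Fin 2) ℂ) * (Complex.I • D ⟨p.src.shift p.ν, p.μ⟩) * star ((W ⟨p.src, p.μ⟩ * W ⟨p.src.shift p.μ, p.ν⟩ * (W ⟨p.src.shift p.ν, p.μ⟩)⁻¹ : Matrix.specialUnitaryGroup (Fin 2) ℂ) : Matrix (Fin 2) (Fin 2) ℂ))
            - (((GaugeField.plaqHol W p : Matrix.specialUnitaryGroup (Fin 2) ℂ) : Matrix (Fin 2) (Fin 2) ℂ) * (Complex.I • D ⟨p.src, p.ν⟩) * star ((GaugeField.plaqHol W p : Matrix.specialUnitaryGroup (Fin 2) ℂ) : Matrix (Fin 2) (Fin 2) ℂ)))‖ ^ 2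
          + (1 / 2) * (((((GaugeField.plaqHol W p : Matrix.specialUnitaryGroup (Fin 2) ℂ) : Matrix (Fin 2) (Fin 2) ℂ) - 1)ᴴ * (((2 : ℂ)⁻¹ • ((Complex.I • D ⟨p.src, p.μ⟩) ^ 2 + ((W ⟨p.src, p.μ⟩ : Matrix (Fin 2) (Fin 2) ℂ) * (Complex.I • D ⟨p.src.shift p.μ, p.ν⟩) * star (W ⟨p.src, p.μ⟩ : Matrix (Fin 2) (Fin 2) ℂ)) ^ 2
              + (((W ⟨p.src, p.μ⟩ * W ⟨p.src.shift p.μ, p.ν⟩ * (W ⟨p.src.shift p.ν, p.μ⟩)⁻¹ : Matrix.specialUnitaryGroup (Fin 2) ℂ) : Matrix (Fin 2) (Fin 2) ℂ) * (Complex.I • D ⟨p.src.shift p.ν, p.μ⟩) * star ((W ⟨p.src, p.μ⟩ * W ⟨p.src.shift p.μ, p.ν⟩ * (W ⟨p.src.shift p.ν, p.μ⟩)⁻¹ : Matrix.specialUnitaryGroup (Fin 2) ℂ) : Matrix (Fin 2) (Fin 2) ℂ)) ^ 2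
              + (((GaugeField.plaqHol W p : Matrix.specialUnitaryGroup (Fin 2) ℂ) : Matrix (Fin 2) (Fin 2) ℂ) * (Complex.I • D ⟨p.src, p.ν⟩) * star ((GaugeField.plaqHol W p : Matrix.specialUnitaryGroup (Fin 2) ℂ) : Matrix (Fin 2) (Fin 2) ℂ)) ^ 2)
            + (Complex.I • D ⟨p.src, p.μ⟩) * ((W ⟨p.src, p.μ⟩ : Matrix (Fin 2) (Fin 2) ℂ) * (Complex.I • D ⟨p.src.shift p.μ, p.ν⟩) * star (W ⟨p.src, p.μ⟩ : Matrix (Fin 2) (Fin 2) ℂ))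
            - (Complex.I • D ⟨p.src, p.μ⟩) * (((W ⟨p.src, p.μ⟩ * W ⟨p.src.shift p.μ, p.ν⟩ * (W ⟨p.src.shift p.ν, p.μ⟩)⁻¹ : Matrix.specialUnitaryGroup (Fin 2) ℂ) : Matrix (Fin 2) (Fin 2) ℂ) * (Complex.I • D ⟨p.src.shift p.ν, p.μ⟩) * star ((W ⟨p.src, p.μ⟩ * W ⟨p.src.shift p.μ, p.ν⟩ * (W ⟨p.src.shift p.ν, p.μ⟩)⁻¹ : Matrix.specialUnitaryGroup (Fin 2) ℂ) : Matrix (Fin 2) (Fin 2) ℂ))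
            - (Complex.I • D ⟨p.src, p.μ⟩) * (((GaugeField.plaqHol W p : Matrix.specialUnitaryGroup (Fin 2) ℂ) : Matrix (Fin 2) (Fin 2) ℂ) * (Complex.I • D ⟨p.src, p.ν⟩) * star ((GaugeField.plaqHol W p : Matrix.specialUnitaryGroup (Fin 2) ℂ) : Matrix (Fin 2) (Fin 2) ℂ))
            - ((W ⟨p.src, p.μ⟩ : Matrix (Fin 2) (Fin 2) ℂ) * (Complex.I • D ⟨p.src.shift p.μ, p.ν⟩) * star (W ⟨p.src, p.μ⟩ : Matrix (Fin 2) (Fin 2) ℂ))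
                * (((W ⟨p.src, p.μ⟩ * W ⟨p.src.shift p.μ, p.ν⟩ * (W ⟨p.src.shift p.ν, p.μ⟩)⁻¹ : Matrix.specialUnitaryGroup (Fin 2) ℂ) : Matrix (Fin 2) (Fin 2) ℂ) * (Complex.I • D ⟨p.src.shift p.ν, p.μ⟩) * star ((W ⟨p.src, p.μ⟩ * W ⟨p.src.shift p.μ, p.ν⟩ * (W ⟨p.src.shift p.ν, p.μ⟩)⁻¹ : Matrix.specialUnitaryGroup (Fin 2) ℂ) : Matrix (Fin 2) (Fin 2) ℂ))
            - ((W ⟨p.src, p.μ⟩ : Matrix (Fin 2) (Fin 2) ℂ) * (Complex.I • D ⟨p.src.shift p.μ, p.ν⟩) * star (W ⟨p.src, p.μ⟩ : Matrix (Fin 2) (Fin 2) ℂ))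
                * (((GaugeField.plaqHol W p : Matrix.specialUnitaryGroup (Fin 2) ℂ) : Matrix (Fin 2) (Fin 2) ℂ) * (Complex.I • D ⟨p.src, p.ν⟩) * star ((GaugeField.plaqHol W p : Matrix.specialUnitaryGroup (Fin 2) ℂ) : Matrix (Fin 2) (Fin 2) ℂ))
            + (((W ⟨p.src, p.μ⟩ * W ⟨p.src.shift p.μ, p.ν⟩ * (W ⟨p.src.shift p.ν, p.μ⟩)⁻¹ : Matrix.specialUnitaryGroup (Fin 2) ℂ) : Matrix (Fin 2) (Fin 2) ℂ) * (Complex.I • D ⟨p.src.shift p.ν, p.μ⟩) * star ((W ⟨p.src, p.μ⟩ * W ⟨p.src.shift p.μ, p.ν⟩ * (W ⟨p.src.shift p.ν, p.μ⟩)⁻¹ : Matrix.specialUnitaryGroup (Fin 2) ℂ) : Matrix (Fin 2) (Fin 2) ℂ))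
                * (((GaugeField.plaqHol W p : Matrix.specialUnitaryGroup (Fin 2) ℂ) : Matrix (Fin 2) (Fin 2) ℂ) * (Complex.I • D ⟨p.src, p.ν⟩) * star ((GaugeField.plaqHol W p : Matrix.specialUnitaryGroup (Fin 2) ℂ) : Matrix (Fin 2) (Fin 2) ℂ))) * ((GaugeField.plaqHol W p : Matrix.specialUnitaryGroup (Fin 2) ℂ) : Matrix (Fin 2) (Fin 2) ℂ))).trace).re) :=
  (abs_le.mp (abs_wilsonAction4_expChart_sub_taylor2_le_curl W D hD hs0 hs hs4 ht0 ha0 ht ha)).1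

end Summit.QuantumFields.YangMills.Theorems.Prop7Taylor3ActionCurl

end
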